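import Mathlib
import HarnessLib
import Summits.QuantumFields.Statement
import Literature.MathematicalPhysics.QuantumFieldTheory.YangMillsOS
import Literature.MathematicalPhysics.QuantumFieldTheory.OSLorentzInvariance

/-!
# Sketch — first lemmas of the crux idea cards for `PencilRigidity.NPointIsotropy`
(planner-cruxidea-stmt-QuantumFields-11686-2-0, round 1). Statements only (Props); nothing proved.
-/

namespace Summit.QuantumFields.YangMills.Cruxes.NPointIsotropy.Sketch

open scoped BigOperators Topology
open Literature.MathematicalPhysics.QuantumLattice Literature.MathematicalPhysics.AQFT
  Literature.MathematicalPhysics.QuantumFieldTheory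

/-- Card `quarter-turn-corner-operator`, FIRST LEMMA (model-blind, provable now).
The diagonal mirror `x₀ = x₁` is the axis mirror `x₀ = 0` followed by the hypercubic quarter-turn
`Rq : e₀ ↦ e₁, e₁ ↦ -e₀` (a det-1 signed permutation). Hence, for a one-species family `S`
invariant on `⁰𝒮` under the proper signed permutations and reflection positive in pull-back form for
the diagonal frame `R_d e₀ = (e₀ - e₁)/√2`, and for time-ordered test functions `G₁, G₂` supported in
the quadrant `Q = {x₀ > 0 > x₁}` (all points), the QUARTER-TURN FORM is
(i) symmetric:  `𝔖(Θ(Rq·G₁)* ⊗ G₂) = 𝔖(ΘG₁* ⊗ Rq·G₂)`  (both equal `𝔖(Θ_diag G₁* ⊗ G₂)`), and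
(ii) positive: `𝔖(Θ(Rq·G)* ⊗ G) ≥ 0` — i.e. `[G] ↦ [Rq·G]` is a positive symmetric operator on
quadrant vectors of the `e₀`-OS space (the continuum corner transfer operator). -/
def QuarterTurnPositiveSymmetric : Prop :=
  let E := EuclideanSpace ℝ (Fin 4)
  ∀ (S : SchwingerFamily E) (Rq Rd : E ≃ₗᵢ[ℝ] E),
    -- Rq = the quarter-turn of the (x₀,x₁)-plane
    Rq (EuclideanSpace.single 0 1) = EuclideanSpace.single 1 1 →
    Rq (EuclideanSpace.single 1 1) = -EuclideanSpace.single 0 1 →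
    Rq (EuclideanSpace.single 2 1) = EuclideanSpace.single 2 1 →
    Rq (EuclideanSpace.single 3 1) = EuclideanSpace.single 3 1 →
    -- Rd = a diagonal frame, time axis (e₀ - e₁)/√2
    (∃ a b : ℝ, a ^ 2 = 1 / 2 ∧ b ^ 2 = 1 / 2 ∧ a * b < 0 ∧ 0 < a ∧
      Rd (EuclideanSpace.single 0 1) = a • EuclideanSpace.single 0 1 + b • EuclideanSpace.single 1 1) →
    -- proper hypercubic invariance on ⁰𝒮
    (∀ (R : E ≃ₗᵢ[ℝ] E), LinearMap.det (R.toLinearEquiv : E →ₗ[ℝ] E) = 1 →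
      (∀ i : Fin 4, ∃ j : Fin 4, R (EuclideanSpace.single i 1) = EuclideanSpace.single j 1 ∨
        R (EuclideanSpace.single i 1) = -EuclideanSpace.single j 1) →
      ∀ (n : ℕ) (F : SchwartzMap (Fin n → E) ℂ), IsOffDiagonal F → S n (linActMulti R F) = S n F) →
    -- diagonal reflection positivity in pull-back form
    (SchwingerFamily.toLabelled (fun n => (S n).comp (linActMulti Rd))).IsReflectionPositive →
    -- conclusion, for quadrant-supported time-ordered G₁ G₂
    ∀ (n m : ℕ) (G₁ : SchwartzMap (Fin n → E) ℂ) (G₂ : SchwartzMap (Fin m → E) ℂ),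
      IsTimeOrdered G₁ → IsTimeOrdered G₂ →
      (∀ x ∈ tsupport G₁, ∀ i, 0 < x i 0 ∧ x i 1 < 0) →
      (∀ x ∈ tsupport G₂, ∀ i, 0 < x i 0 ∧ x i 1 < 0) →
      IsTimeOrdered (linActMulti Rq G₁) → IsTimeOrdered (linActMulti Rq G₂) →
      (∀ (H H' : SchwartzMap (Fin (n + m) → E) ℂ),
        IsAppendTensorOf H (osAdjoint (linActMulti Rq G₁)) G₂ →
        IsAppendTensorOf H' (osAdjoint G₁) (linActMulti Rq G₂) →
        S (n + m) H = S (n + m) H') ∧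
      (∀ (H : SchwartzMap (Fin (n + n) → E) ℂ),
        IsAppendTensorOf H (osAdjoint (linActMulti Rq G₁)) G₁ →
        0 ≤ (S (n + n) H).re ∧ (S (n + n) H).im = 0)

/-- Card `entire-complex-angle-bandlimit`, FIRST LEMMA (model-blind; the analytic engine).
For a one-species family with linear growth, symmetry, translation invariance, proper hypercubic
invariance and reflection positivity in the eight frames of the (x₀,x₁)-plane, and for an
off-diagonal test function `F` supported in GENERIC planar configurations (at no rotation angle do a
pair with equal x₀ and a pair with equal x₁ occur simultaneously), the rotated correlator
`θ ↦ 𝔖ₙ(R_θ · F)` is the restriction to `ℝ` of an ENTIRE function of the complex angle, `π/2`-periodic,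
of finite exponential type in `Im`: hence a trigonometric polynomial in `e^{4iθ}` — the anisotropy of
`𝔖ₙ` is band-limited. (Engine: planar spectral cone from the diagonal mirrors; real boosts preserve
the planar forward tube and the real-part tube of the `e₁`-frame; the two continuations glue on the
Euclidean quadrant.) -/
def EntireComplexAngle : Prop :=
  let E := EuclideanSpace ℝ (Fin 4)
  ∀ (S : SchwingerFamily E),
    S.toLabelled.HasLinearGrowth → S.toLabelled.IsSymmetric →
    (∀ (n : ℕ) (a : E) (F : SchwartzMap (Fin n → E) ℂ), IsOffDiagonal F →
      S n (translateMulti a F) = S n F) →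
    (∀ (R : E ≃ₗᵢ[ℝ] E), LinearMap.det (R.toLinearEquiv : E →ₗ[ℝ] E) = 1 →
      (∀ i : Fin 4, ∃ j : Fin 4, R (EuclideanSpace.single i 1) = EuclideanSpace.single j 1 ∨
        R (EuclideanSpace.single i 1) = -EuclideanSpace.single j 1) →
      ∀ (n : ℕ) (F : SchwartzMap (Fin n → E) ℂ), IsOffDiagonal F → S n (linActMulti R F) = S n F) →
    (∀ (R : E ≃ₗᵢ[ℝ] E) (a b : ℝ), a ^ 2 + b ^ 2 = 1 → (a = 0 ∨ b = 0 ∨ a ^ 2 = b ^ 2) →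
      R (EuclideanSpace.single 0 1) = a • EuclideanSpace.single 0 1 + b • EuclideanSpace.single 1 1 →
      (SchwingerFamily.toLabelled (fun n => (S n).comp (linActMulti R))).IsReflectionPositive) →
    ∀ (n : ℕ) (F : SchwartzMap (Fin n → E) ℂ), IsOffDiagonal F →
      (∀ x ∈ tsupport F, ∀ θ : ℝ,
        (∀ i j : Fin n, i ≠ j → (planeRot (d := 3) 0 θ (x i)) 0 ≠ (planeRot (d := 3) 0 θ (x j)) 0) ∨
        (∀ i j : Fin n, i ≠ j → (planeRot (d := 3) 0 θ (x i)) 1 ≠ (planeRot (d := 3) 0 θ (x j)) 1)) →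
      ∃ (Φ : ℂ → ℂ) (C N : ℝ), Differentiable ℂ Φ ∧
        (∀ θ : ℝ, Φ θ = S n (linActMulti (planeRot (d := 3) 0 θ) F)) ∧
        (∀ z : ℂ, Φ (z + (Real.pi / 2 : ℝ)) = Φ z) ∧
        (∀ z : ℂ, ‖Φ z‖ ≤ C * Real.exp (N * |z.im|))

/-- Card `entire-complex-angle-bandlimit`, the TRANSFER target C⁺ in its sharpest usable form:
sub-threshold growth of the entire angle function kills every anisotropic harmonic (Liouville on the
Fourier coefficients `c_k = O(e^{-(4|k| - N)|Im z|})`). Pure complex analysis, provable now. -/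
def PeriodicEntireSubThreshold : Prop :=
  ∀ (Φ : ℂ → ℂ) (C N : ℝ), N < 4 → Differentiable ℂ Φ →
    (∀ z : ℂ, Φ (z + (Real.pi / 2 : ℝ)) = Φ z) →
    (∀ z : ℂ, ‖Φ z‖ ≤ C * Real.exp (N * |z.im|)) →
    ∀ z w : ℂ, Φ z = Φ w

/-- Shared support lemma `one-angle amplification` (pure group theory + continuity, provable now):
a family invariant on `⁰𝒮` under ALL signed permutations (the proper ones are in W₁; the improper
ones follow from E2 + E0-hermiticity + E3 as in `PencilRigidity.KernelTransfer`) and under ONE rotation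
of the (x₀,x₁)-plane by an angle `α ∉ (π/2)ℤ` is invariant under every linear isometry: the group
generated by the hyperoctahedral rotations and `R_α` is infinite (two rotations by `α` about
perpendicular axes of a 3-space generate an infinite group unless `α ∈ (π/2)ℤ`, by the list of finite
subgroups of SO(3)), its closure has a nonzero W(B₄)-invariant Lie algebra, and `so(4) = Λ²₊ ⊕ Λ²₋` is
W(B₄)-irreducible; the invariance group of a tempered family is closed. Consequence for the crux: it
suffices to prove planar invariance at ONE angle (e.g. `π/4`: "the square root of the corner operator
is geometric"; or one value `Ξ_F(π/4) = Ξ_F(0)` of the entire angle function). -/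
def OneAngleAmplification : Prop :=
  let E := EuclideanSpace ℝ (Fin 4)
  ∀ (S : SchwingerFamily E),
    (∀ (R : E ≃ₗᵢ[ℝ] E),
      (∀ i : Fin 4, ∃ j : Fin 4, R (EuclideanSpace.single i 1) = EuclideanSpace.single j 1 ∨
        R (EuclideanSpace.single i 1) = -EuclideanSpace.single j 1) →
      ∀ (n : ℕ) (F : SchwartzMap (Fin n → E) ℂ), IsOffDiagonal F → S n (linActMulti R F) = S n F) →
    ∀ α : ℝ, (∀ k : ℤ, α ≠ k * (Real.pi / 2)) →
      (∀ (n : ℕ) (F : SchwartzMap (Fin n → E) ℂ), IsOffDiagonal F →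
        S n (linActMulti (planeRot (d := 3) 0 α) F) = S n F) →
      ∀ (R : E ≃ₗᵢ[ℝ] E) (n : ℕ) (F : SchwartzMap (Fin n → E) ℂ), IsOffDiagonal F →
        S n (linActMulti R F) = S n F

end Summit.QuantumFields.YangMills.Cruxes.NPointIsotropy.Sketch
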